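import Summits.BirchSwinnertonDyer.Rank1Residual.P2.CMKolyvaginCartanCommuteAtTwo
import HarnessLib

/-!
# Route `CMKolyvaginAtInertTwo`, crux `CMKolyvaginExactAtInertTwo` (stmt-BirchSwinnertonDyer-24277):
# the binder `hcomm` (part 2/3: `E[2^M]` is cyclic over `ℤ[η]`, the ENGINE, transport lemmas)

Cell `bsd-print-cf2`, seat ty2 (discharge interface). HONEST FRAMING: THEOREMS ONLY — no definition,
no named fact, no route file imported, nothing about BSD asserted; no item is closed by this file.
Continuation of `CMKolyvaginCartanCommuteAtTwo` (see its docstring for the whole argument):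

* §4 `E[2^M] = ℤ·P₁ + ℤ·ηP₁` for a point `P₁` of exact order `2^M` (`exists_coords`, induction on the
  level through §1; `exists_exact_order` from `#E[2^n] = 4^n`), so two Galois elements commuting
  with `η` commute with each other on `E[2^M]` (`smul_comm_of_commute`: both composites are the same
  polynomial in `η` evaluated at `P₁`, and `ℤ[η]` is commutative);
* §5 THE ENGINE `smul_comm_geomTorsion_of_cmGenerator`: `η ∈ End_{k̄}(E)` with `η² + mη = c`, `m`, `c`
  odd, `char k = 0` ⟹ `hcomm` in the consumers' binder shape, for EVERY `z` without non-zero fixed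
  point on `E[2]` and every `π ∈ Γ_{k(E[2])}`;
* §6 TRANSPORT of the conclusion along an additive map `f : E(k̄) → E'(k̄')` equivariant for a map
  `r : Γ' → Γ` and injective on `2`-power torsion (`#E[2^n] = #E'[2^n] = 4^n`): push-forward
  (`smul_comm_push`, for base change along `res : Γ_K → Γ_ℚ`) and pull-back (`smul_comm_pull`, for a
  `k`-rational isogeny of odd degree or a `k`-isomorphism);
* §7 the engine on bare points (`smul_comm_of_cmGenerator`), the shape §6 consumes.

beyond-print theorem: NO. BSD is not proved by any of this; no summit statement is proved by this seat.

References: S. Lang, *Elliptic Functions*, GTM 112 (1987), Ch. 10 §4 Remark [Lang1987];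
B. Gross, LMS LN 153 (1991), §9 Prop. 9.1 [GrossLMS1991]; J. H. Silverman, *AEC* 2nd ed.,
Cor. III.6.4(b) [SilvermanAEC2009].
-/

set_option autoImplicit false

noncomputable section

open scoped Classical

namespace Summit.BirchSwinnertonDyer.Rank1Residual.P2.CartanAtTwo

open WeierstrassCurve Field
open Literature.NumberTheory.EllipticCurves

universe u

/-! ## §4 `E[2^M] = ℤ P₁ + ℤ ηP₁`, and commutation on `E[2^M]` -/

section Level

variable {k : Type u} [Field k] {V : WeierstrassCurve k} {η : AddMonoid.End (geomPoints V)} {m c : ℤ}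

/-- **Coordinates on `E[2^j]`**: if `2^j P₁ = 0` and `2^{j-1} P₁ ≠ 0` (for `j ≥ 1`), every `P` with
`2^j P = 0` is `a·P₁ + b·ηP₁` with integers `a, b` — `E[2^j]` is cyclic over `ℤ[η]` (induction on `j`:
`2P ∈ E[2^{j-1}] = ℤ·2P₁ + ℤ·η(2P₁)`, and the difference lies in `E[2] = {0, Q, ηQ, Q + ηQ}`,
`Q = 2^{j-1}P₁`). [cite: SilvermanAEC2009, Cor. III.6.4(b)] -/
theorem exists_coords (hrel : ∀ P : geomPoints V, η (η P) + m • η P = c • P)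
    (hm : Odd m) (hc : Odd c) (hcard : Nat.card (geomTorsion V ((2 : ℕ) : ℤ)) = 4) :
    ∀ (j : ℕ) (P₁ : geomPoints V), (2 : ℤ) ^ j • P₁ = 0 → (j = 0 ∨ (2 : ℤ) ^ (j - 1) • P₁ ≠ 0) →
      ∀ P : geomPoints V, (2 : ℤ) ^ j • P = 0 → ∃ a b : ℤ, P = a • P₁ + b • η P₁ := by
  intro j
  induction j with
  | zero =>
    intro P₁ _ _ P hP
    rw [pow_zero, one_zsmul] at hP
    exact ⟨0, 0, by rw [hP, zero_zsmul, zero_zsmul, add_zero]⟩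
  | succ j ih =>
    intro P₁ h1 hne P hP
    have hne' : (2 : ℤ) ^ j • P₁ ≠ 0 := by
      rcases hne with h | h
      · exact absurd h (Nat.succ_ne_zero j)
      · simpa only [Nat.add_sub_cancel] using h
    -- the induction hypothesis at `2 • P₁`
    have h1' : (2 : ℤ) ^ j • (2 : ℤ) • P₁ = 0 := by rw [smul_smul, ← pow_succ, h1]
    have hne'' : j = 0 ∨ (2 : ℤ) ^ (j - 1) • (2 : ℤ) • P₁ ≠ 0 := by
      rcases Nat.eq_zero_or_pos j with hj | hj
      · exact Or.inl hj
      · right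
        rw [smul_smul, ← pow_succ, Nat.sub_add_cancel hj]
        exact hne'
    have hP' : (2 : ℤ) ^ j • (2 : ℤ) • P = 0 := by rw [smul_smul, ← pow_succ, hP]
    obtain ⟨a, b, hab⟩ := ih ((2 : ℤ) • P₁) h1' hne'' ((2 : ℤ) • P) hP'
    rw [map_zsmul] at hab
    -- the difference is `2`-torsion
    have hR : (2 : ℤ) • (P - a • P₁ - b • η P₁) = 0 := by
      rw [zsmul_sub, zsmul_sub, hab]; module
    -- `Q = 2^j P₁ ≠ 0` is `2`-torsion
    have h2Q : (2 : ℤ) • (2 : ℤ) ^ j • P₁ = 0 := by rw [smul_smul, ← pow_succ', h1]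
    rcases two_torsion_cases hrel hm hc hcard hne' h2Q _ hR with h | h | h | h
    · exact ⟨a, b, by rw [sub_sub, sub_eq_zero] at h; rw [h]⟩
    · refine ⟨a + 2 ^ j, b, ?_⟩
      rw [sub_sub, sub_eq_iff_eq_add] at h
      rw [h]; module
    · refine ⟨a, b + 2 ^ j, ?_⟩
      rw [sub_sub, sub_eq_iff_eq_add, map_zsmul] at h
      rw [h]; module
    · refine ⟨a + 2 ^ j, b + 2 ^ j, ?_⟩
      rw [sub_sub, sub_eq_iff_eq_add, map_zsmul] at h
      rw [h]; module

/-- **A point of exact order `2^M`** (`M ≥ 1`): from `#E[2^M] = 4^M > 4^{M-1} = #E[2^{M-1}]`.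
[cite: SilvermanAEC2009, Cor. III.6.4(b)] -/
theorem exists_exact_order (hcards : ∀ n : ℕ, Nat.card (geomTorsion V ((2 ^ n : ℕ) : ℤ)) = 4 ^ n)
    {M : ℕ} (hM : 1 ≤ M) :
    ∃ P₁ : geomPoints V, (2 : ℤ) ^ M • P₁ = 0 ∧ (2 : ℤ) ^ (M - 1) • P₁ ≠ 0 := by
  by_contra hall
  push Not at hall
  haveI : Finite (geomTorsion V ((2 ^ (M - 1) : ℕ) : ℤ)) :=
    Nat.finite_of_card_ne_zero (by rw [hcards]; positivity)
  have hle : geomTorsion V ((2 ^ M : ℕ) : ℤ) ≤ geomTorsion V ((2 ^ (M - 1) : ℕ) : ℤ) := by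
    intro P hP
    rw [mem_geomTorsion_iff] at hP ⊢
    push_cast at hP ⊢
    exact hall P hP
  have hcard_le := AddSubgroup.card_le_of_le hle
  rw [hcards, hcards] at hcard_le
  have hlt : 4 ^ (M - 1) < 4 ^ M := Nat.pow_lt_pow_right (by norm_num) (by omega)
  omega

/-- Linearity of an `η`-commuting Galois element on `ℤ P + ℤ ηP`. [folklore] -/
theorem smul_coords {ρ : absoluteGaloisGroup k} (hρ : ∀ P : geomPoints V, ρ • η P = η (ρ • P))
    (a b : ℤ) (X : geomPoints V) : ρ • (a • X + b • η X) = a • ρ • X + b • η (ρ • X) := by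
  rw [smul_add, smul_zsmul_geomPoints, smul_zsmul_geomPoints, hρ]

/-- **Two Galois elements commuting with `η` commute with each other on `E[2^M]`** (`#E[2^n] = 4^n`):
with `P₁` of exact order `2^M` and coordinates `σP₁ = a₁P₁ + b₁ηP₁`, `τP₁ = a₂P₁ + b₂ηP₁`,
`P = aP₁ + bηP₁`, both `στP` and `τσP` equal `(a + bη)(a₁ + b₁η)(a₂ + b₂η)P₁` — the ring `ℤ[η]` is
commutative. [cite: Lang1987, Ch. 10 §4, Remark] -/
theorem smul_comm_of_commute (hrel : ∀ P : geomPoints V, η (η P) + m • η P = c • P)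
    (hm : Odd m) (hc : Odd c)
    (hcards : ∀ n : ℕ, Nat.card (geomTorsion V ((2 ^ n : ℕ) : ℤ)) = 4 ^ n)
    {σ τ : absoluteGaloisGroup k} (hσ : ∀ P : geomPoints V, σ • η P = η (σ • P))
    (hτ : ∀ P : geomPoints V, τ • η P = η (τ • P)) (M : ℕ) (P : geomPoints V)
    (hP : ((2 ^ M : ℕ) : ℤ) • P = 0) : σ • τ • P = τ • σ • P := by
  have hcard : Nat.card (geomTorsion V ((2 : ℕ) : ℤ)) = 4 := by simpa using hcards 1
  rcases Nat.eq_zero_or_pos M with hM | hM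
  · subst hM
    rw [pow_zero, Nat.cast_one, one_zsmul] at hP
    simp only [hP, smul_zero]
  obtain ⟨P₁, h1, hne⟩ := exists_exact_order hcards hM
  have hP' : (2 : ℤ) ^ M • P = 0 := by exact_mod_cast hP
  have gen := exists_coords hrel hm hc hcard M P₁ h1 (Or.inr hne)
  -- coordinates of `σ P₁`, `τ P₁`, `P`
  have hσ1 : (2 : ℤ) ^ M • σ • P₁ = 0 := by rw [← smul_zsmul_geomPoints V _ σ P₁, h1, smul_zero]
  have hτ1 : (2 : ℤ) ^ M • τ • P₁ = 0 := by rw [← smul_zsmul_geomPoints V _ τ P₁, h1, smul_zero]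
  obtain ⟨a₁, b₁, hσP₁⟩ := gen (σ • P₁) hσ1
  obtain ⟨a₂, b₂, hτP₁⟩ := gen (τ • P₁) hτ1
  obtain ⟨a, b, hPab⟩ := gen P hP'
  -- on the generator
  have key : σ • τ • P₁ = τ • σ • P₁ := by
    rw [hτP₁, smul_coords hσ, hσP₁, map_add, map_zsmul, map_zsmul, smul_coords hτ, hτP₁,
      map_add, map_zsmul, map_zsmul]
    module
  have keyη : σ • τ • η P₁ = τ • σ • η P₁ := by
    rw [hτ, hσ, key, ← hτ, ← hσ]
  rw [hPab, smul_add, smul_add, smul_zsmul_geomPoints, smul_zsmul_geomPoints,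
    smul_zsmul_geomPoints, smul_zsmul_geomPoints, key, keyη, smul_add, smul_add,
    smul_zsmul_geomPoints, smul_zsmul_geomPoints, smul_zsmul_geomPoints, smul_zsmul_geomPoints]

end Level

/-! ## §5 The engine: `hcomm` from a CM generator inert at `2` -/

section Engine

variable {k : Type u} [Field k] (V : WeierstrassCurve k) [CharZero k] [V.IsElliptic]

/-- `#E[2^n] = 4^n` over a field of characteristic `0`. [cite: SilvermanAEC2009, Cor. III.6.4(b)] -/
theorem natCard_geomTorsion_two_pow (n : ℕ) :
    Nat.card (geomTorsion V ((2 ^ n : ℕ) : ℤ)) = 4 ^ n := by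
  haveI : CharZero (AlgebraicClosure k) :=
    charZero_of_injective_algebraMap (algebraMap k (AlgebraicClosure k)).injective
  rw [show (4 : ℕ) ^ n = (2 ^ n) ^ 2 by rw [← pow_mul, mul_comm, pow_mul]; norm_num]
  exact card_torsionPoints_eq_sq_holds V (AlgebraicClosure k) (n := 2 ^ n)
    (by exact_mod_cast pow_ne_zero n two_ne_zero)

omit [CharZero k] [V.IsElliptic] in
/-- Pointwise form of the relation `η ∘ η + m·η = c`. [folklore] -/
theorem rel_apply {η : AddMonoid.End (geomPoints V)} {m c : ℤ}
    (hrel : η * η + (m : AddMonoid.End (geomPoints V)) * η = (c : AddMonoid.End (geomPoints V)))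
    (P : geomPoints V) : η (η P) + m • η P = c • P := by
  have h := congrArg (fun f : AddMonoid.End (geomPoints V) ↦ f P) hrel
  change (η * η) P + ((m : AddMonoid.End (geomPoints V)) * η) P =
    (c : AddMonoid.End (geomPoints V)) P at h
  simpa only [AddMonoid.End.coe_mul, Function.comp_apply, AddMonoid.End.intCast_apply] using h

/-- **THE ENGINE (binder `hcomm` of the level-`2^M` Kolyvagin machine at `p = 2`).** Let `E/k`
(`char k = 0`) carry `η ∈ End_{k̄}(E)` with `η² + mη = c`, `m` and `c` odd — `2` is inert in
`ℤ[η]`. Then for every `z ∈ Γ_k` WITHOUT non-zero fixed point on `E[2]` and every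
`π ∈ Γ_{k(E[2])}`, `π` and `z` commute on `E[2^M]`, for every `M`: both commute with `η` (§3),
and `E[2^M]` is cyclic over the commutative ring `ℤ[η]` (§4). [cite: Lang1987, Ch. 10 §4, Remark]
[cite: GrossLMS1991, §9 Prop. 9.1] -/
theorem smul_comm_geomTorsion_of_cmGenerator {η : AddMonoid.End (geomPoints V)} {m c : ℤ}
    (hη : η ∈ V.geomEndRing)
    (hrel : η * η + (m : AddMonoid.End (geomPoints V)) * η = (c : AddMonoid.End (geomPoints V)))
    (hm : Odd m) (hc : Odd c) {z : absoluteGaloisGroup k}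
    (hz : ∀ P : geomTorsion V ((2 : ℕ) : ℤ), z • P = P → P = 0)
    {π : absoluteGaloisGroup k} (hπ : π ∈ torsionFixing V ((2 : ℕ) : ℤ)) {M : ℕ}
    (P : geomTorsion V ((2 ^ M : ℕ) : ℤ)) : π • z • P = z • π • P := by
  have hcards := natCard_geomTorsion_two_pow V
  have hcard : Nat.card (geomTorsion V ((2 : ℕ) : ℤ)) = 4 := by simpa using hcards 1
  have hrel' := rel_apply V hrel
  have mem : ∀ {R : geomPoints V}, (2 : ℤ) • R = 0 → R ∈ geomTorsion V ((2 : ℕ) : ℤ) := fun h ↦ by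
    rw [mem_geomTorsion_iff]; exact_mod_cast h
  have hz' : ∀ P : geomPoints V, (2 : ℤ) • P = 0 → z • P = P → P = 0 := fun P h2 hfix ↦
    congrArg Subtype.val (hz ⟨P, mem h2⟩ (Subtype.ext hfix))
  have hπ' : ∀ P : geomPoints V, (2 : ℤ) • P = 0 → π • P = P := fun P h2 ↦
    congrArg Subtype.val ((mem_torsionFixing_iff V _).mp hπ ⟨P, mem h2⟩)
  have hzη := commute_of_fixedPointFree hrel' hm hc hcard (dichotomy V hη hrel z) hz'
  have hπη := commute_of_trivial hm hcard (dichotomy V hη hrel π) hπ'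
  apply Subtype.ext
  simp only [AddSubgroup.torsionBy.coe_smul]
  exact (smul_comm_of_commute hrel' hm hc hcards hzη hπη M (P : geomPoints V)
    ((mem_geomTorsion_iff V _ _).mp P.2)).symm

end Engine

/-! ## §6 Transport of the conclusion along equivariant maps injective on `2`-power torsion -/

section Transport

variable {k : Type u} [Field k] {V : WeierstrassCurve k} {k' : Type u} [Field k']
  {V' : WeierstrassCurve k'}

/-- An additive map injective on `E[2^n]` with `#E[2^n] = #E'[2^n]` finite maps `E[2^n]` ONTO
`E'[2^n]`. [folklore] -/
theorem exists_preimage_torsion (f : geomPoints V →+ geomPoints V') (n : ℕ)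
    (hinj : ∀ P : geomPoints V, ((2 ^ n : ℕ) : ℤ) • P = 0 → f P = 0 → P = 0)
    (hV : Nat.card (geomTorsion V ((2 ^ n : ℕ) : ℤ)) = 4 ^ n)
    (hV' : Nat.card (geomTorsion V' ((2 ^ n : ℕ) : ℤ)) = 4 ^ n)
    (P' : geomPoints V') (hP' : ((2 ^ n : ℕ) : ℤ) • P' = 0) :
    ∃ P : geomPoints V, ((2 ^ n : ℕ) : ℤ) • P = 0 ∧ f P = P' := by
  haveI : Finite (geomTorsion V' ((2 ^ n : ℕ) : ℤ)) := Nat.finite_of_card_ne_zero (by rw [hV']; positivity)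
  have mem : ∀ P : geomTorsion V ((2 ^ n : ℕ) : ℤ), f P ∈ geomTorsion V' ((2 ^ n : ℕ) : ℤ) := by
    intro P
    rw [mem_geomTorsion_iff, ← map_zsmul, (mem_geomTorsion_iff V _ _).mp P.2, map_zero]
  let g : geomTorsion V ((2 ^ n : ℕ) : ℤ) → geomTorsion V' ((2 ^ n : ℕ) : ℤ) :=
    fun P ↦ ⟨f P, mem P⟩
  have ginj : Function.Injective g := by
    intro P Q hPQ
    have h : f (P - Q : geomTorsion V ((2 ^ n : ℕ) : ℤ)) = 0 := by
      have h' : f P = f Q := congrArg Subtype.val hPQ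
      rw [AddSubgroupClass.coe_sub, map_sub, h', sub_self]
    have h0 := hinj _ ((mem_geomTorsion_iff V _ _).mp (P - Q).2) h
    exact sub_eq_zero.mp (Subtype.ext h0)
  have gbij : Function.Bijective g := ginj.bijective_of_nat_card_le (by rw [hV, hV'])
  obtain ⟨P, hP⟩ := gbij.2 ⟨P', (mem_geomTorsion_iff V' _ _).mpr hP'⟩
  exact ⟨P, (mem_geomTorsion_iff V _ _).mp P.2, congrArg Subtype.val hP⟩

/-- **PUSH-FORWARD** (base change). Let `f : E(k̄) → E'(k̄')` be additive, equivariant along a map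
`r : Γ' → Γ` (`f(r γ • P) = γ • f P`), injective on `2`-power torsion, with `#E[2^n] = #E'[2^n] = 4^n`.
If on `E` every element of `Γ` without non-zero fixed point on `E[2]` commutes on `E[2^M]` with every
element trivial on `E[2]`, the same holds on `E'` for `Γ'`. [folklore] -/
theorem smul_comm_push {Γ Γ' : Type*} [Group Γ] [Group Γ']
    [DistribMulAction Γ (geomPoints V)] [DistribMulAction Γ' (geomPoints V')]
    (f : geomPoints V →+ geomPoints V') (r : Γ' → Γ)
    (hf : ∀ (γ : Γ') (P : geomPoints V), f (r γ • P) = γ • f P)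
    (hinj : ∀ (n : ℕ) (P : geomPoints V), ((2 ^ n : ℕ) : ℤ) • P = 0 → f P = 0 → P = 0)
    (hV : ∀ n : ℕ, Nat.card (geomTorsion V ((2 ^ n : ℕ) : ℤ)) = 4 ^ n)
    (hV' : ∀ n : ℕ, Nat.card (geomTorsion V' ((2 ^ n : ℕ) : ℤ)) = 4 ^ n) (M : ℕ)
    (hcomm : ∀ σ τ : Γ, (∀ P : geomPoints V, (2 : ℤ) • P = 0 → σ • P = P → P = 0) →
      (∀ P : geomPoints V, (2 : ℤ) • P = 0 → τ • P = P) →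
      ∀ P : geomPoints V, ((2 ^ M : ℕ) : ℤ) • P = 0 → τ • σ • P = σ • τ • P)
    {z π : Γ'} (hz : ∀ P : geomPoints V', (2 : ℤ) • P = 0 → z • P = P → P = 0)
    (hπ : ∀ P : geomPoints V', (2 : ℤ) • P = 0 → π • P = P)
    (P' : geomPoints V') (hP' : ((2 ^ M : ℕ) : ℤ) • P' = 0) : π • z • P' = z • π • P' := by
  have h2f : ∀ P : geomPoints V, (2 : ℤ) • P = 0 → (2 : ℤ) • f P = 0 := fun P h ↦ by
    rw [← map_zsmul, h, map_zero]
  have hinj1 : ∀ P : geomPoints V, (2 : ℤ) • P = 0 → f P = 0 → P = 0 := fun P h ↦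
    hinj 1 P (by simpa using h)
  have hrz : ∀ P : geomPoints V, (2 : ℤ) • P = 0 → r z • P = P → P = 0 := by
    intro P h2 hfix
    refine hinj1 P h2 (hz _ (h2f P h2) ?_)
    rw [← hf, hfix]
  have hrπ : ∀ P : geomPoints V, (2 : ℤ) • P = 0 → r π • P = P := by
    intro P h2
    have h : f (r π • P - P) = 0 := by rw [map_sub, hf, hπ _ (h2f P h2), sub_self]
    have h2' : (2 : ℤ) • (r π • P - P) = 0 := by rw [zsmul_sub, smul_comm, h2, smul_zero, sub_zero]
    exact sub_eq_zero.mp (hinj1 _ h2' h)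
  obtain ⟨P, hP, rfl⟩ := exists_preimage_torsion f M (hinj M) (hV M) (hV' M) P' hP'
  have e1 : π • z • f P = f (r π • r z • P) := by rw [← hf z, ← hf π]
  have e2 : z • π • f P = f (r z • r π • P) := by rw [← hf π, ← hf z]
  rw [e1, e2, hcomm (r z) (r π) hrz hrπ P hP]

/-- **PULL-BACK** (isogeny). Let `f : E(k̄) → E'(k̄)` be additive, `Γ`-equivariant, injective on
`2`-power torsion, with `#E[2^n] = #E'[2^n] = 4^n`. If the commutation property holds on `E'`, it
holds on `E`. [folklore] -/
theorem smul_comm_pull {Γ : Type*} [Group Γ]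
    [DistribMulAction Γ (geomPoints V)] [DistribMulAction Γ (geomPoints V')]
    (f : geomPoints V →+ geomPoints V')
    (hf : ∀ (γ : Γ) (P : geomPoints V), f (γ • P) = γ • f P)
    (hinj : ∀ (n : ℕ) (P : geomPoints V), ((2 ^ n : ℕ) : ℤ) • P = 0 → f P = 0 → P = 0)
    (hV : ∀ n : ℕ, Nat.card (geomTorsion V ((2 ^ n : ℕ) : ℤ)) = 4 ^ n)
    (hV' : ∀ n : ℕ, Nat.card (geomTorsion V' ((2 ^ n : ℕ) : ℤ)) = 4 ^ n) (M : ℕ)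
    (hcomm : ∀ σ τ : Γ, (∀ P : geomPoints V', (2 : ℤ) • P = 0 → σ • P = P → P = 0) →
      (∀ P : geomPoints V', (2 : ℤ) • P = 0 → τ • P = P) →
      ∀ P : geomPoints V', ((2 ^ M : ℕ) : ℤ) • P = 0 → τ • σ • P = σ • τ • P)
    {z π : Γ} (hz : ∀ P : geomPoints V, (2 : ℤ) • P = 0 → z • P = P → P = 0)
    (hπ : ∀ P : geomPoints V, (2 : ℤ) • P = 0 → π • P = P)
    (P : geomPoints V) (hP : ((2 ^ M : ℕ) : ℤ) • P = 0) : π • z • P = z • π • P := by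
  have hinj1 : ∀ P : geomPoints V, (2 : ℤ) • P = 0 → f P = 0 → P = 0 := fun P h ↦
    hinj 1 P (by simpa using h)
  have hV1 : Nat.card (geomTorsion V ((2 ^ 1 : ℕ) : ℤ)) = 4 ^ 1 := hV 1
  have hV1' : Nat.card (geomTorsion V' ((2 ^ 1 : ℕ) : ℤ)) = 4 ^ 1 := hV' 1
  -- `z` is fixed-point free on `E'[2]`, `π` is trivial on `E'[2]`
  have hz' : ∀ P' : geomPoints V', (2 : ℤ) • P' = 0 → z • P' = P' → P' = 0 := by
    intro P' h2 hfix
    obtain ⟨Q, hQ, rfl⟩ := exists_preimage_torsion f 1 (hinj 1) hV1 hV1' P' (by simpa using h2)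
    have h2Q : (2 : ℤ) • Q = 0 := by simpa using hQ
    have h2zQ : (2 : ℤ) • (z • Q - Q) = 0 := by rw [zsmul_sub, smul_comm, h2Q, smul_zero, sub_zero]
    have h0 : z • Q - Q = 0 := hinj1 _ h2zQ (by rw [map_sub, hf, hfix, sub_self])
    rw [hz Q h2Q (sub_eq_zero.mp h0), map_zero]
  have hπ' : ∀ P' : geomPoints V', (2 : ℤ) • P' = 0 → π • P' = P' := by
    intro P' h2
    obtain ⟨Q, hQ, rfl⟩ := exists_preimage_torsion f 1 (hinj 1) hV1 hV1' P' (by simpa using h2)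
    rw [← hf, hπ Q (by simpa using hQ)]
  have h : f (π • z • P - z • π • P) = 0 := by
    rw [map_sub, hf π (z • P), hf z P, hf z (π • P), hf π P,
      hcomm z π hz' hπ' (f P) (by rw [← map_zsmul, hP, map_zero]), sub_self]
  have hzs : ∀ (γ : Γ) (n : ℤ) (Q : geomPoints V), γ • n • Q = n • γ • Q := fun γ n Q ↦
    map_zsmul (DistribSMul.toAddMonoidHom (geomPoints V) γ) n Q
  have h2 : ((2 ^ M : ℕ) : ℤ) • (π • z • P - z • π • P) = 0 := by
    rw [zsmul_sub, ← hzs π, ← hzs z, ← hzs z, ← hzs π, hP]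
    simp only [smul_zero, sub_self]
  exact sub_eq_zero.mp (hinj M _ h2 h)

end Transport

/-! ## §7 The engine in transportable (unbundled) form -/

section Unbundled

variable {k : Type u} [Field k] (V : WeierstrassCurve k) [CharZero k] [V.IsElliptic]

/-- The engine of §5 stated on bare points (the shape consumed by §6). [cite: Lang1987, Ch. 10 §4, Remark] -/
theorem smul_comm_of_cmGenerator {η : AddMonoid.End (geomPoints V)} {m c : ℤ}
    (hη : η ∈ V.geomEndRing)
    (hrel : η * η + (m : AddMonoid.End (geomPoints V)) * η = (c : AddMonoid.End (geomPoints V)))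
    (hm : Odd m) (hc : Odd c) (M : ℕ) (σ τ : absoluteGaloisGroup k)
    (hσ : ∀ P : geomPoints V, (2 : ℤ) • P = 0 → σ • P = P → P = 0)
    (hτ : ∀ P : geomPoints V, (2 : ℤ) • P = 0 → τ • P = P)
    (P : geomPoints V) (hP : ((2 ^ M : ℕ) : ℤ) • P = 0) : τ • σ • P = σ • τ • P := by
  have hcards := natCard_geomTorsion_two_pow V
  have hcard : Nat.card (geomTorsion V ((2 : ℕ) : ℤ)) = 4 := by simpa using hcards 1
  have hrel' := rel_apply V hrel
  have hση := commute_of_fixedPointFree hrel' hm hc hcard (dichotomy V hη hrel σ) hσ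
  have hτη := commute_of_trivial hm hcard (dichotomy V hη hrel τ) hτ
  exact (smul_comm_of_commute hrel' hm hc hcards hση hτη M P hP).symm

end Unbundled

end Summit.BirchSwinnertonDyer.Rank1Residual.P2.CartanAtTwo

end
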